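import Summits.QuantumFields.YangMills.Theorems.LuscherReductionTwistedTraceScalingBOStiffTensorPoincare
import HarnessLib

/-!
# (B-ST) flat Poincaré, step 2 with KILLING SLACK: tensorisation of a Poincaré inequality that carries a mass slack
# (lane A of S-BASE, crux `TwistedTraceScaling` stmt-QuantumFields-20203, C4-CORE, the (B-ST) pen; HANDOFF-g21 UPDATE 21:40Z hflat chain; cdisprove R63)

`…BOStiffTensorPoincare.variance_tensor_le` tensorises an EXACT Poincaré inequality on `Y` with independent resampling on `Z`.  On the truncated stiff ball the Mehler
Poincaré inequality is only available in the censored form with a killing (mass) slack `δ_Y ∫ h² D_Y` (R63 `killed_transfer_door`); this file shows the slack passes through the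
tensorisation as the same mass slack:
★★★ `variance_tensor_le_slack` — with `hPY : Var_Y(h) ≤ P·½∫∫(δh)²J + δ_Y ∫h²D_Y` for all bounded measurable `h` (and `D_Y ≥ 0`):
`Var_{D_Y⊗D_Z}(g) ≤ (max P (1/r₀)/∫D_Z)·½∫∫ J(y,y')(∫∫(g(y,z)−g(y',z'))²D_ZD_Z') + δ_Y·∫∫ g² D_Y D_Z` (the fibre functional `A(y)²/∫D_Z ≤ S(y)` absorbs the slack).
HONEST FRAMING: bookkeeping for a stub of a child of the CONDITIONAL route R2b1; (B-ST) OPEN; C4-CORE OPEN; not infinite volume, not a gap, not Clay.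
-/

set_option autoImplicit false

noncomputable section

open MeasureTheory

namespace Summit.QuantumFields.YangMills.Theorems.FemtoTransferGap.StiffDoor

variable {Y Z : Type*} [MeasurableSpace Y] [MeasurableSpace Z] {μ : Measure Y} {κ : Measure Z} [IsFiniteMeasure μ] [IsFiniteMeasure κ]

section TensorSlack

variable {g : Y × Z → ℝ} {DY : Y → ℝ} {DZ : Z → ℝ} {J : Y → Y → ℝ} {Cg CY CZ CJ P r₀ δY : ℝ}

set_option maxHeartbeats 800000 in
/-- ★★★ **Tensorisation with a mass slack** (see the module docstring; `variance_tensor_le` is the case `δ_Y = 0`). [folklore] -/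
theorem variance_tensor_le_slack (hg : Measurable g) (hgb : ∀ p, |g p| ≤ Cg) (hDY : Measurable DY) (hDYb : ∀ y, |DY y| ≤ CY) (hDY0 : ∀ y, 0 ≤ DY y) (hδY : 0 ≤ δY)
    (hDZ : Measurable DZ) (hDZb : ∀ z, |DZ z| ≤ CZ) (hDZ0 : ∀ z, 0 ≤ DZ z) (hJ : Measurable (Function.uncurry J)) (hJb : ∀ y y', |J y y'| ≤ CJ) (hJ0 : ∀ y y', 0 ≤ J y y')
    (hsymm : ∀ y y', J y y' = J y' y) (hP : 0 ≤ P) (hr₀ : 0 < r₀) (hR : ∀ y, r₀ * DY y ≤ ∫ y', J y y' ∂μ) (hMY : 0 < ∫ y, DY y ∂μ) (hMZ : 0 < ∫ z, DZ z ∂κ)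
    (hPY : ∀ h : Y → ℝ, Measurable h → (∃ C : ℝ, ∀ y, |h y| ≤ C) →
      (∫ y, h y ^ 2 * DY y ∂μ) - (∫ y, h y * DY y ∂μ) ^ 2 / (∫ y, DY y ∂μ) ≤ P * ((1 / 2) * ∫ y, ∫ y', (h y - h y') ^ 2 * J y y' ∂μ ∂μ) + δY * ∫ y, h y ^ 2 * DY y ∂μ) :
    (∫ y, DY y * ∫ z, g (y, z) ^ 2 * DZ z ∂κ ∂μ) - (∫ y, DY y * ∫ z, g (y, z) * DZ z ∂κ ∂μ) ^ 2 / ((∫ y, DY y ∂μ) * ∫ z, DZ z ∂κ) ≤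
      (max P (1 / r₀) / ∫ z, DZ z ∂κ) * ((1 / 2) * ∫ y, ∫ y', J y y' * (∫ z, ∫ z', (g (y, z) - g (y', z')) ^ 2 * (DZ z * DZ z') ∂κ ∂κ) ∂μ ∂μ) +
        δY * (∫ y, DY y * ∫ z, g (y, z) ^ 2 * DZ z ∂κ ∂μ) := by
  -- the fibre moments `A`, `S` and the row sums `R`
  obtain ⟨hAm, hAb⟩ := measurable_integral_fibre (κ := κ) (F := fun p : Y × Z => g p * DZ p.2) (hg.mul (hDZ.comp measurable_snd)) (C := Cg * CZ) fun p => by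
    rw [abs_mul]; exact mul_le_mul (hgb p) (hDZb p.2) (abs_nonneg _) ((abs_nonneg _).trans (hgb p))
  obtain ⟨hSm, hSb⟩ := measurable_integral_fibre (κ := κ) (F := fun p : Y × Z => g p ^ 2 * DZ p.2) ((hg.pow_const 2).mul (hDZ.comp measurable_snd)) (C := Cg ^ 2 * CZ)
    fun p => by rw [abs_mul, abs_pow]; exact mul_le_mul (pow_le_pow_left₀ (abs_nonneg _) (hgb p) 2) (hDZb p.2) (abs_nonneg _) (sq_nonneg _)
  obtain ⟨hRm, hRb⟩ := measurable_integral_right_of_bdd (μ := μ) hJ hJb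
  set MZ := ∫ z, DZ z ∂κ with hMZdef
  set MY := ∫ y, DY y ∂μ with hMYdef
  set A : Y → ℝ := fun y => ∫ z, g (y, z) * DZ z ∂κ with hAdef
  set S : Y → ℝ := fun y => ∫ z, g (y, z) ^ 2 * DZ z ∂κ with hSdef
  set R : Y → ℝ := fun y => ∫ y', J y y' ∂μ with hRdef
  have hAm' : Measurable A := hAm
  have hSm' : Measurable S := hSm
  have hAb' : ∀ y, |A y| ≤ Cg * CZ * κ.real Set.univ := hAb
  have hSb' : ∀ y, |S y| ≤ Cg ^ 2 * CZ * κ.real Set.univ := hSb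
  have hRb' : ∀ y, |R y| ≤ CJ * μ.real Set.univ := hRb
  have hR0 : ∀ y, 0 ≤ R y := fun y => integral_nonneg fun y' => hJ0 y y'
  have hH : ∀ y, A y ^ 2 / MZ ≤ S y := fun y => sq_moment_div_le (κ := κ) hg hgb hDZ hDZb hDZ0 hMZ y
  -- the `z`-integrated jump integrand
  have hinner : ∀ y y', ∫ z, ∫ z', (g (y, z) - g (y', z')) ^ 2 * (DZ z * DZ z') ∂κ ∂κ = MZ * S y + MZ * S y' - 2 * (A y * A y') :=
    fun y y' => inner_jump_eq (κ := κ) hg hgb hDZ hDZb y y'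
  -- the double integrals
  set IS : ℝ := ∫ y, S y * R y ∂μ with hIS
  set IA : ℝ := ∫ y, A y ^ 2 * R y ∂μ with hIA
  set X : ℝ := ∫ y, ∫ y', J y y' * (A y * A y') ∂μ ∂μ with hX
  have hA2m : Measurable fun y => A y ^ 2 := hAm'.pow_const 2
  have hA2b : ∀ y, |A y ^ 2| ≤ (Cg * CZ * κ.real Set.univ) ^ 2 := fun y => by rw [abs_pow]; exact pow_le_pow_left₀ (abs_nonneg _) (hAb' y) 2
  -- (I1) the jump form
  have hT : ∫ y, ∫ y', J y y' * (∫ z, ∫ z', (g (y, z) - g (y', z')) ^ 2 * (DZ z * DZ z') ∂κ ∂κ) ∂μ ∂μ = MZ * IS + MZ * IS - 2 * X := by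
    have e : (fun y => ∫ y', J y y' * (∫ z, ∫ z', (g (y, z) - g (y', z')) ^ 2 * (DZ z * DZ z') ∂κ ∂κ) ∂μ) =
        fun y => ∫ y', ((MZ * (J y y' * S y) + MZ * (J y y' * S y')) - 2 * (J y y' * (A y * A y'))) ∂μ := by
      funext y; refine integral_congr_ae (ae_of_all _ fun y' => ?_); dsimp only; rw [hinner y y']; ring
    rw [e]
    -- pass to the product measure for linearity
    have m1 : Measurable (Function.uncurry fun y y' => J y y' * S y) := hJ.mul (hSm'.comp measurable_fst)
    have m2 : Measurable (Function.uncurry fun y y' => J y y' * S y') := hJ.mul (hSm'.comp measurable_snd)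
    have m3 : Measurable (Function.uncurry fun y y' => J y y' * (A y * A y')) := hJ.mul ((hAm'.comp measurable_fst).mul (hAm'.comp measurable_snd))
    have hCJ0 : ∀ y y', 0 ≤ CJ := fun y y' => (abs_nonneg _).trans (hJb y y')
    have b1 : ∀ y y', |J y y' * S y| ≤ CJ * (Cg ^ 2 * CZ * κ.real Set.univ) := fun y y' => by
      rw [abs_mul]; exact mul_le_mul (hJb y y') (hSb' y) (abs_nonneg _) (hCJ0 y y')
    have b2 : ∀ y y', |J y y' * S y'| ≤ CJ * (Cg ^ 2 * CZ * κ.real Set.univ) := fun y y' => by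
      rw [abs_mul]; exact mul_le_mul (hJb y y') (hSb' y') (abs_nonneg _) (hCJ0 y y')
    have b3 : ∀ y y', |J y y' * (A y * A y')| ≤ CJ * ((Cg * CZ * κ.real Set.univ) * (Cg * CZ * κ.real Set.univ)) := fun y y' => by
      rw [abs_mul, abs_mul]
      exact mul_le_mul (hJb y y') (mul_le_mul (hAb' y) (hAb' y') (abs_nonneg _) ((abs_nonneg _).trans (hAb' y))) (mul_nonneg (abs_nonneg _) (abs_nonneg _)) (hCJ0 y y')
    have i1 : Integrable (fun p : Y × Y => J p.1 p.2 * S p.1) (μ.prod μ) := integrable_prod_of_bdd (μ := μ) m1 b1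
    have i2 : Integrable (fun p : Y × Y => J p.1 p.2 * S p.2) (μ.prod μ) := integrable_prod_of_bdd (μ := μ) m2 b2
    have i3 : Integrable (fun p : Y × Y => J p.1 p.2 * (A p.1 * A p.2)) (μ.prod μ) := integrable_prod_of_bdd (μ := μ) m3 b3
    have mall : Measurable (Function.uncurry fun y y' => (MZ * (J y y' * S y) + MZ * (J y y' * S y')) - 2 * (J y y' * (A y * A y'))) :=
      ((m1.const_mul MZ).add (m2.const_mul MZ)).sub (m3.const_mul 2)
    have ball : ∀ y y', |(MZ * (J y y' * S y) + MZ * (J y y' * S y')) - 2 * (J y y' * (A y * A y'))| ≤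
        |MZ| * (CJ * (Cg ^ 2 * CZ * κ.real Set.univ)) + |MZ| * (CJ * (Cg ^ 2 * CZ * κ.real Set.univ)) + 2 * (CJ * ((Cg * CZ * κ.real Set.univ) * (Cg * CZ * κ.real Set.univ))) :=
      fun y y' => by
        refine (abs_sub _ _).trans (add_le_add ((abs_add_le _ _).trans (add_le_add ?_ ?_)) ?_)
        · rw [abs_mul]; exact mul_le_mul_of_nonneg_left (b1 y y') (abs_nonneg _)
        · rw [abs_mul]; exact mul_le_mul_of_nonneg_left (b2 y y') (abs_nonneg _)
        · rw [abs_mul, abs_two]; exact mul_le_mul_of_nonneg_left (b3 y y') (by norm_num)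
    rw [integral_integral_eq_prod (μ := μ) mall ball]
    have i12 : Integrable (fun p : Y × Y => MZ * (J p.1 p.2 * S p.1) + MZ * (J p.1 p.2 * S p.2)) (μ.prod μ) := (i1.const_mul MZ).add (i2.const_mul MZ)
    have i3' : Integrable (fun p : Y × Y => 2 * (J p.1 p.2 * (A p.1 * A p.2))) (μ.prod μ) := i3.const_mul 2
    rw [integral_sub i12 i3', integral_add (i1.const_mul MZ) (i2.const_mul MZ), integral_const_mul, integral_const_mul, integral_const_mul]
    have f1 : ∫ p, J p.1 p.2 * S p.1 ∂(μ.prod μ) = IS := by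
      rw [← integral_integral_eq_prod (μ := μ) m1 b1, integral_integral_kernel_mul_left]
    have f2 : ∫ p, J p.1 p.2 * S p.2 ∂(μ.prod μ) = IS := by
      rw [← integral_integral_eq_prod (μ := μ) m2 b2, integral_integral_kernel_mul_right hJ hJb hsymm hSm' hSb']
    have f3 : ∫ p, J p.1 p.2 * (A p.1 * A p.2) ∂(μ.prod μ) = X := by rw [← integral_integral_eq_prod (μ := μ) m3 b3]
    rw [f1, f2, f3]
  -- (I2) the flat jump form of `A`
  have hE2 : ∫ y, ∫ y', (A y - A y') ^ 2 * J y y' ∂μ ∂μ = IA + IA - 2 * X := by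
    have m1 : Measurable (Function.uncurry fun y y' => J y y' * A y ^ 2) := hJ.mul (hA2m.comp measurable_fst)
    have m2 : Measurable (Function.uncurry fun y y' => J y y' * A y' ^ 2) := hJ.mul (hA2m.comp measurable_snd)
    have m3 : Measurable (Function.uncurry fun y y' => J y y' * (A y * A y')) := hJ.mul ((hAm'.comp measurable_fst).mul (hAm'.comp measurable_snd))
    have hCJ0 : ∀ y y', 0 ≤ CJ := fun y y' => (abs_nonneg _).trans (hJb y y')
    have b1 : ∀ y y', |J y y' * A y ^ 2| ≤ CJ * (Cg * CZ * κ.real Set.univ) ^ 2 := fun y y' => by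
      rw [abs_mul]; exact mul_le_mul (hJb y y') (hA2b y) (abs_nonneg _) (hCJ0 y y')
    have b2 : ∀ y y', |J y y' * A y' ^ 2| ≤ CJ * (Cg * CZ * κ.real Set.univ) ^ 2 := fun y y' => by
      rw [abs_mul]; exact mul_le_mul (hJb y y') (hA2b y') (abs_nonneg _) (hCJ0 y y')
    have b3 : ∀ y y', |J y y' * (A y * A y')| ≤ CJ * ((Cg * CZ * κ.real Set.univ) * (Cg * CZ * κ.real Set.univ)) := fun y y' => by
      rw [abs_mul, abs_mul]
      exact mul_le_mul (hJb y y') (mul_le_mul (hAb' y) (hAb' y') (abs_nonneg _) ((abs_nonneg _).trans (hAb' y))) (mul_nonneg (abs_nonneg _) (abs_nonneg _)) (hCJ0 y y')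
    have i1 : Integrable (fun p : Y × Y => J p.1 p.2 * A p.1 ^ 2) (μ.prod μ) := integrable_prod_of_bdd (μ := μ) m1 b1
    have i2 : Integrable (fun p : Y × Y => J p.1 p.2 * A p.2 ^ 2) (μ.prod μ) := integrable_prod_of_bdd (μ := μ) m2 b2
    have i3 : Integrable (fun p : Y × Y => J p.1 p.2 * (A p.1 * A p.2)) (μ.prod μ) := integrable_prod_of_bdd (μ := μ) m3 b3
    have mall : Measurable (Function.uncurry fun y y' => (A y - A y') ^ 2 * J y y') := (((hAm'.comp measurable_fst).sub (hAm'.comp measurable_snd)).pow_const 2).mul hJ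
    have ball : ∀ y y', |(A y - A y') ^ 2 * J y y'| ≤ (2 * (Cg * CZ * κ.real Set.univ)) ^ 2 * CJ := fun y y' => by
      rw [abs_mul, abs_pow]
      exact mul_le_mul (pow_le_pow_left₀ (abs_nonneg _) ((abs_sub _ _).trans (by linarith [hAb' y, hAb' y'])) 2) (hJb y y') (abs_nonneg _) (sq_nonneg _)
    rw [integral_integral_eq_prod (μ := μ) mall ball]
    have e2 : ∫ p : Y × Y, (A p.1 - A p.2) ^ 2 * J p.1 p.2 ∂(μ.prod μ) =
        ∫ p, ((J p.1 p.2 * A p.1 ^ 2 + J p.1 p.2 * A p.2 ^ 2) - 2 * (J p.1 p.2 * (A p.1 * A p.2))) ∂(μ.prod μ) :=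
      integral_congr_ae (ae_of_all _ fun p => by ring)
    have i12 : Integrable (fun p : Y × Y => J p.1 p.2 * A p.1 ^ 2 + J p.1 p.2 * A p.2 ^ 2) (μ.prod μ) := i1.add i2
    rw [e2, integral_sub i12 (i3.const_mul 2), integral_add i1 i2, integral_const_mul]
    have f1 : ∫ p, J p.1 p.2 * A p.1 ^ 2 ∂(μ.prod μ) = IA := by
      rw [← integral_integral_eq_prod (μ := μ) m1 b1, integral_integral_kernel_mul_left]
    have f2 : ∫ p, J p.1 p.2 * A p.2 ^ 2 ∂(μ.prod μ) = IA := by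
      rw [← integral_integral_eq_prod (μ := μ) m2 b2, integral_integral_kernel_mul_right hJ hJb hsymm hA2m hA2b]
    have f3 : ∫ p, J p.1 p.2 * (A p.1 * A p.2) ∂(μ.prod μ) = X := by rw [← integral_integral_eq_prod (μ := μ) m3 b3]
    rw [f1, f2, f3]
  -- the flat Poincaré inequality for `A`
  have hPA := hPY A hAm' ⟨_, hAb'⟩
  rw [hE2] at hPA
  -- the variance splits: `∫ D_Y S − (∫ D_Y A)²/(M_Y M_Z) = ∫ D_Y (S − A²/M_Z) + (∫ D_Y A² − (∫ D_Y A)²/M_Y)/M_Z`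
  have iDS : Integrable (fun y => DY y * S y) μ := integrable_of_measurable_abs_le μ (hDY.mul hSm') (C := CY * (Cg ^ 2 * CZ * κ.real Set.univ)) fun y => by
    rw [abs_mul]; exact mul_le_mul (hDYb y) (hSb' y) (abs_nonneg _) ((abs_nonneg _).trans (hDYb y))
  have iDA2 : Integrable (fun y => DY y * (A y ^ 2 / MZ)) μ := integrable_of_measurable_abs_le μ (hDY.mul (hA2m.div_const MZ)) (C := CY * ((Cg * CZ * κ.real Set.univ) ^ 2 / |MZ|))
    fun y => by
      rw [abs_mul, abs_div]
      exact mul_le_mul (hDYb y) (div_le_div_of_nonneg_right (hA2b y) (abs_nonneg _)) (div_nonneg (abs_nonneg _) (abs_nonneg _)) ((abs_nonneg _).trans (hDYb y))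
  have iRS : Integrable (fun y => R y * S y) μ := integrable_of_measurable_abs_le μ (hRm.mul hSm') (C := (CJ * μ.real Set.univ) * (Cg ^ 2 * CZ * κ.real Set.univ)) fun y => by
    rw [abs_mul]; exact mul_le_mul (hRb' y) (hSb' y) (abs_nonneg _) ((abs_nonneg _).trans (hRb' y))
  have iRA2 : Integrable (fun y => R y * (A y ^ 2 / MZ)) μ := integrable_of_measurable_abs_le μ (hRm.mul (hA2m.div_const MZ))
    (C := (CJ * μ.real Set.univ) * ((Cg * CZ * κ.real Set.univ) ^ 2 / |MZ|)) fun y => by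
      rw [abs_mul, abs_div]
      exact mul_le_mul (hRb' y) (div_le_div_of_nonneg_right (hA2b y) (abs_nonneg _)) (div_nonneg (abs_nonneg _) (abs_nonneg _)) ((abs_nonneg _).trans (hRb' y))
  -- `∫ D_Y·(S − A²/M_Z) ≤ (1/r₀) ∫ R·(S − A²/M_Z)`
  have hstep1 : ∫ y, (DY y * S y - DY y * (A y ^ 2 / MZ)) ∂μ ≤ (1 / r₀) * ∫ y, (R y * S y - R y * (A y ^ 2 / MZ)) ∂μ := by
    rw [← integral_const_mul]
    refine integral_mono (iDS.sub iDA2) ((iRS.sub iRA2).const_mul _) fun y => ?_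
    dsimp only
    have h1 := hH y
    have h2 := hR y
    have h3 : DY y ≤ (1 / r₀) * R y := by rw [div_mul_eq_mul_div, le_div_iff₀ hr₀, one_mul, mul_comm]; exact h2
    have h4 : 0 ≤ S y - A y ^ 2 / MZ := by linarith
    nlinarith [mul_le_mul_of_nonneg_right h3 h4]
  rw [integral_sub iDS iDA2, integral_sub iRS iRA2] at hstep1
  -- express `∫ D_Y A²/M_Z`, `∫ R A²/M_Z`, `∫ R S`, `∫ D_Y A²` in terms of the named integrals
  have eDA2 : ∫ y, DY y * (A y ^ 2 / MZ) ∂μ = (∫ y, A y ^ 2 * DY y ∂μ) / MZ := by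
    rw [← integral_div]; exact integral_congr_ae (ae_of_all _ fun y => by ring)
  have eRA2 : ∫ y, R y * (A y ^ 2 / MZ) ∂μ = IA / MZ := by
    rw [hIA, ← integral_div]; exact integral_congr_ae (ae_of_all _ fun y => by ring)
  have eRS : ∫ y, R y * S y ∂μ = IS := by rw [hIS]; exact integral_congr_ae (ae_of_all _ fun y => by ring)
  have eDA : (∫ y, DY y * ∫ z, g (y, z) * DZ z ∂κ ∂μ) = ∫ y, A y * DY y ∂μ := integral_congr_ae (ae_of_all _ fun y => by simp only [hAdef]; ring)
  have eDS : (∫ y, DY y * ∫ z, g (y, z) ^ 2 * DZ z ∂κ ∂μ) = ∫ y, DY y * S y ∂μ := rfl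
  rw [eDA2, eRA2, eRS] at hstep1
  rw [hT, eDA, eDS]
  -- positivity of the two pieces of the jump form
  have hX_le : X ≤ IA := by
    -- `IA − X = ½·∫∫(A−A')²J ≥ 0`
    have h0 : 0 ≤ ∫ y, ∫ y', (A y - A y') ^ 2 * J y y' ∂μ ∂μ := integral_nonneg fun y => integral_nonneg fun y' => mul_nonneg (sq_nonneg _) (hJ0 y y')
    rw [hE2] at h0; linarith
  have hIS_ge : IA / MZ ≤ IS := by
    -- `∫ R·(S − A²/M_Z) ≥ 0`
    have h0 : 0 ≤ ∫ y, (R y * S y - R y * (A y ^ 2 / MZ)) ∂μ := integral_nonneg fun y => by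
      have h4 : 0 ≤ S y - A y ^ 2 / MZ := sub_nonneg.mpr (hH y)
      have h5 := mul_nonneg (hR0 y) h4
      show 0 ≤ R y * S y - R y * (A y ^ 2 / MZ)
      linarith [h5, mul_sub (R y) (S y) (A y ^ 2 / MZ)]
    rw [integral_sub iRS iRA2, eRS, eRA2] at h0; linarith
  -- assemble the real-number inequality
  set N := ∫ y, DY y * S y ∂μ
  set m := ∫ y, A y * DY y ∂μ
  set Q := ∫ y, A y ^ 2 * DY y ∂μ
  have hmax1 : P ≤ max P (1 / r₀) := le_max_left _ _
  have hmax2 : 1 / r₀ ≤ max P (1 / r₀) := le_max_right _ _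
  have hmax0 : 0 ≤ max P (1 / r₀) := hP.trans hmax1
  -- `N − m²/(M_Y M_Z) = (N − Q/M_Z) + (Q − m²/M_Y)/M_Z`
  have esplit : N - m ^ 2 / (MY * MZ) = (N - Q / MZ) + (Q - m ^ 2 / MY) / MZ := by field_simp; ring
  rw [esplit]
  -- piece 1: `N − Q/M_Z ≤ (1/r₀)(IS − IA/M_Z)`; piece 2: `(Q − m²/M_Y) ≤ P(IA − X)` i.e. `/M_Z`
  have hp2 : (Q - m ^ 2 / MY) / MZ ≤ (P * (IA - X) + δY * Q) / MZ := div_le_div_of_nonneg_right (by linarith [hPA]) hMZ.le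
  -- the slack: `Q/M_Z ≤ N`
  have hQN : Q / MZ ≤ N := by
    rw [← eDA2]
    exact integral_mono iDA2 iDS fun y => by
      dsimp only
      exact mul_le_mul_of_nonneg_left (hH y) (hDY0 y)
  have hslack : (P * (IA - X) + δY * Q) / MZ = P * (IA - X) / MZ + δY * (Q / MZ) := by field_simp
  rw [hslack] at hp2
  have hsl2 : δY * (Q / MZ) ≤ δY * N := mul_le_mul_of_nonneg_left hQN hδY
  have hgoal : (1 / r₀) * (IS - IA / MZ) + P * (IA - X) / MZ ≤ (max P (1 / r₀) / MZ) * ((1 / 2) * (MZ * IS + MZ * IS - 2 * X)) := by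
    have e1 : (max P (1 / r₀) / MZ) * ((1 / 2) * (MZ * IS + MZ * IS - 2 * X)) = max P (1 / r₀) * (IS - IA / MZ) + max P (1 / r₀) * ((IA - X) / MZ) := by
      field_simp; ring
    rw [e1]
    have t1 : (1 / r₀) * (IS - IA / MZ) ≤ max P (1 / r₀) * (IS - IA / MZ) := mul_le_mul_of_nonneg_right hmax2 (by linarith)
    have t2 : P * (IA - X) / MZ ≤ max P (1 / r₀) * ((IA - X) / MZ) := by
      rw [mul_div_assoc]; exact mul_le_mul_of_nonneg_right hmax1 (div_nonneg (by linarith) hMZ.le)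
    linarith
  linarith [hstep1, hp2, hgoal, hsl2]


end TensorSlack

end Summit.QuantumFields.YangMills.Theorems.FemtoTransferGap.StiffDoor

end
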